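import Summits.ValiantsHypothesis.ValiantsHypothesis.Theses.LangWeilTransfer
import Summits.ValiantsHypothesis.ValiantsHypothesis.Theorems.LangWeilTransferLangWeilBoundFinOne
import Literature.NumberTheory.DiophantineGeometry.CafureMateraThm52Proofs
import Literature.NumberTheory.DiophantineGeometry.CafureMateraLemma22Proofs

/-!
# LangWeilTransfer, support item `LangWeilBound` (stmt-ValiantsHypothesis-6376) — PROVED

Route `LangWeilTransfer` of `ValiantsHypothesis`, support item `LangWeilBound` ("effective
Lang–Weil with avoidance"): there is `a` (here `a = 6`) such that over every finite field `K`, an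
absolutely irreducible `Q ∈ K[x_0..x_m]` and `G` with `Q ∤ G` have a common point `Q(x) = 0 ≠ G(x)`
as soon as `a (deg Q + 1)^a (deg G + 1)^a < |K|`. Both inputs are PROVED theorems of the tree:
Cafure–Matera Thm. 5.2 (`CafureMatera2006_thm52_holds`:
`#V(Q)(𝔽_q) ≥ q^{n-1} - (δ-1)(δ-2)q^{n-3/2} - 5δ^{13/3}q^{n-2}`) and Lemma 2.2
(`CafureMatera2006_lemma22_holds`: `#V(Q,G)(𝔽_q) ≤ δ'^2 q^{n-2}` for `Q, G` coprime over `𝔽̄_q`);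
this file is the arithmetic `q > 6 D^6`, `D = (δ+1)(e+1)` ⇒ `#V(Q) > #V(Q,G)` for `m ≥ 1`
(`exists_point_of_pos`), the coprimality over `K̄` coming from `Q ∤ G` by descent
(`isRelPrime_map_of_not_dvd`), and the univariate case `m = 0` (`exists_point_fin_one`).
With the landed `transferGlue_proof`, the route's Theorem T (`TameTransfer`) now hangs on exactly
`GoodReduction` and `TameResolution`. Honest framing: bookkeeping inside a dormant route whose
cruxes are open; nothing here bears on VP ≠ VNP.
-/

noncomputable section

open MvPolynomial

-- the summit and the problem share the name `ValiantsHypothesis` (D-0017 single-conjunct layout)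
set_option linter.dupNamespace false

namespace Summit.ValiantsHypothesis.ValiantsHypothesis.Theorems.LangWeilTransfer

open Literature.NumberTheory.DiophantineGeometry

/-- The real inequality behind the threshold `q > 6 D^6`: `D² √q + 5 D⁵ + D² < q`. -/
theorem threshold_ineq {q s D : ℝ} (hD : 2 ≤ D) (hs : 0 < s) (hsq : s * s = q)
    (hq : 6 * D ^ 6 < q) : D ^ 2 * s + 5 * D ^ 5 + D ^ 2 < q := by
  have hD0 : 0 < D := by linarith
  have hD6 : 0 ≤ D ^ 6 := pow_nonneg hD0.le 6
  have h1 : 2 * D ^ 3 < s := by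
    have h : (2 * D ^ 3) ^ 2 < s ^ 2 := by
      rw [show (2 * D ^ 3) ^ 2 = 4 * D ^ 6 by ring, sq, hsq]
      linarith
    exact lt_of_pow_lt_pow_left₀ 2 hs.le h
  have h2 : 4 * (D ^ 2 * s) ≤ 2 * D ^ 3 * s := by
    have h := mul_nonneg (sub_nonneg.mpr hD) (mul_nonneg (sq_nonneg D) hs.le)
    nlinarith [h]
  have h3 : 2 * D ^ 3 * s < q := by
    have h := mul_pos (sub_pos.mpr h1) hs
    nlinarith [h]
  have hD2 : D ^ 2 ≤ D ^ 5 := pow_le_pow_right₀ (by linarith) (by norm_num)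
  have hD5 : 2 * D ^ 5 ≤ D ^ 6 := by
    have h := mul_nonneg (sub_nonneg.mpr hD) (pow_pos hD0 5).le
    nlinarith [h]
  linarith

/-- An absolutely irreducible polynomial has positive total degree. -/
theorem totalDegree_pos_of_absIrreducible {K : Type*} [Field K] {σ : Type*}
    {Q : MvPolynomial σ K}
    (hQ : Irreducible (MvPolynomial.map (algebraMap K (AlgebraicClosure K)) Q)) :
    1 ≤ Q.totalDegree := by
  by_contra h
  have h0 : Q.totalDegree = 0 := by omega
  rw [totalDegree_eq_zero_iff_eq_C] at h0
  have hQ0 : Q ≠ 0 := by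
    rintro rfl
    rw [map_zero] at hQ
    exact not_irreducible_zero hQ
  have hc : coeff 0 Q ≠ 0 := fun hc => hQ0 (by rw [h0, hc, C_0])
  apply hQ.not_isUnit
  rw [h0, map_C]
  exact (isUnit_iff_ne_zero.mpr ((map_ne_zero _).mpr hc)).map C

/-- **`LangWeilBound` for `m ≥ 1` variables beyond the first** (i.e. `n = m + 1 ≥ 2`): the
Cafure–Matera count of `𝔽_q`-points of `V(Q)` exceeds the count of common zeros of `Q, G`. -/
theorem exists_point_of_pos {K : Type} [Field K] [Fintype K] (k : ℕ)
    (Q G : MvPolynomial (Fin (k + 1 + 1)) K)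
    (hQ : Irreducible (MvPolynomial.map (algebraMap K (AlgebraicClosure K)) Q)) (hG : ¬ Q ∣ G)
    (hlt : 6 * (Q.totalDegree + 1) ^ 6 * (G.totalDegree + 1) ^ 6 < Fintype.card K) :
    ∃ x : Fin (k + 1 + 1) → K, MvPolynomial.aeval x Q = 0 ∧ MvPolynomial.aeval x G ≠ 0 := by
  classical
  have hQ0 : Q ≠ 0 := by
    rintro rfl
    rw [map_zero] at hQ
    exact not_irreducible_zero hQ
  have hG0 : G ≠ 0 := fun h => hG (h ▸ dvd_zero Q)
  have hδ1 := totalDegree_pos_of_absIrreducible hQ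
  -- the two counts
  have hZ := CafureMatera2006_lemma22_holds K (k + 1 + 1) (Q.totalDegree + G.totalDegree + 1) Q G
    hQ0 hG0 (by omega) (by omega) (by omega) (isRelPrime_map_of_not_dvd hQ hG)
  have hN := CafureMatera2006_thm52_holds.lower (K := K) (f := Q) hQ
  rw [show k + 1 + 1 - 2 = k by omega] at hZ
  -- names for the real arithmetic
  set N := rationalPointCount Q with hNdef
  set Z := commonZeroCount Q G with hZdef
  set δ := Q.totalDegree with hδ
  set e := G.totalDegree with he
  set qn := Fintype.card K with hqn
  have hq1 : 1 < qn := Fintype.one_lt_card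
  set q : ℝ := (qn : ℝ) with hq
  have hq0 : (0 : ℝ) < q := by rw [hq]; exact_mod_cast (by omega : 0 < qn)
  -- exponents
  have E1 : q ^ (((k + 1 + 1 : ℕ) : ℝ) - 1) = q ^ (k + 1) := by
    rw [show ((k + 1 + 1 : ℕ) : ℝ) - 1 = ((k + 1 : ℕ) : ℝ) by push_cast; ring, Real.rpow_natCast]
  have E2 : q ^ (((k + 1 + 1 : ℕ) : ℝ) - 3 / 2) = q ^ k * Real.sqrt q := by
    rw [show ((k + 1 + 1 : ℕ) : ℝ) - 3 / 2 = (k : ℝ) + 1 / 2 by push_cast; ring,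
      Real.rpow_add hq0, Real.rpow_natCast, Real.sqrt_eq_rpow]
  have E3 : q ^ (((k + 1 + 1 : ℕ) : ℝ) - 2) = q ^ k := by
    rw [show ((k + 1 + 1 : ℕ) : ℝ) - 2 = (k : ℝ) by push_cast; ring, Real.rpow_natCast]
  rw [E1, E2, E3] at hN
  -- the data in `ℝ`
  set s := Real.sqrt q with hs
  have hs0 : 0 < s := Real.sqrt_pos.mpr hq0
  have hsq : s * s = q := Real.mul_self_sqrt hq0.le
  set D : ℝ := ((δ : ℝ) + 1) * ((e : ℝ) + 1) with hD
  have hδ1' : (1 : ℝ) ≤ δ := by exact_mod_cast hδ1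
  have he0 : (0 : ℝ) ≤ e := by positivity
  have hD2 : 2 ≤ D := by rw [hD]; nlinarith
  have hδD : (δ : ℝ) ≤ D := by rw [hD]; nlinarith
  have hthr : 6 * D ^ 6 < q := by
    have : ((6 * (δ + 1) ^ 6 * (e + 1) ^ 6 : ℕ) : ℝ) < (qn : ℝ) := by exact_mod_cast hlt
    rw [hD, mul_pow, hq]
    push_cast at this
    linarith
  have hmain := threshold_ineq hD2 hs0 hsq hthr
  -- `Z ≤ D² q^k`
  have hZle : (Z : ℝ) ≤ D ^ 2 * q ^ k := by
    have h1 : (Z : ℝ) ≤ ((δ + e + 1 : ℕ) : ℝ) ^ 2 * q ^ k := by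
      rw [hq]; exact_mod_cast hZ
    have h2 : ((δ + e + 1 : ℕ) : ℝ) ≤ D := by rw [hD]; push_cast; nlinarith
    have h3 : ((δ + e + 1 : ℕ) : ℝ) ^ 2 ≤ D ^ 2 := pow_le_pow_left₀ (by positivity) h2 2
    exact h1.trans (mul_le_mul_of_nonneg_right h3 (pow_nonneg hq0.le k))
  -- `N ≥ q^{k+1} - D² q^k s - 5 D⁵ q^k`
  have hqk : (0 : ℝ) ≤ q ^ k := pow_nonneg hq0.le k
  have hA : ((δ : ℝ) - 1) * ((δ : ℝ) - 2) ≤ D ^ 2 := by nlinarith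
  have hB : (δ : ℝ) ^ ((13 : ℝ) / 3) ≤ D ^ 5 := by
    have h1 : (δ : ℝ) ^ ((13 : ℝ) / 3) ≤ (δ : ℝ) ^ ((5 : ℕ) : ℝ) :=
      Real.rpow_le_rpow_of_exponent_le hδ1' (by norm_num)
    rw [Real.rpow_natCast] at h1
    exact h1.trans (pow_le_pow_left₀ (by positivity) hδD 5)
  have hNge : q ^ (k + 1) - (D ^ 2 * (q ^ k * s) + 5 * D ^ 5 * q ^ k) ≤ (N : ℝ) := by
    have h1 : ((δ : ℝ) - 1) * ((δ : ℝ) - 2) * (q ^ k * s) ≤ D ^ 2 * (q ^ k * s) :=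
      mul_le_mul_of_nonneg_right hA (mul_nonneg hqk hs0.le)
    have h2 : 5 * (δ : ℝ) ^ ((13 : ℝ) / 3) * q ^ k ≤ 5 * D ^ 5 * q ^ k := by
      have := mul_le_mul_of_nonneg_right hB hqk
      linarith
    linarith
  -- conclude `Z < N`
  have hlt' : (Z : ℝ) < N := by
    have hk1 : q ^ (k + 1) = q ^ k * q := pow_succ q k
    have : D ^ 2 * q ^ k + (D ^ 2 * (q ^ k * s) + 5 * D ^ 5 * q ^ k) < q ^ (k + 1) := by
      rw [hk1]
      have hqk' : (0 : ℝ) < q ^ k := pow_pos hq0 k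
      have h := mul_lt_mul_of_pos_left hmain hqk'
      linarith
    linarith
  have hZN : Z < N := by exact_mod_cast hlt'
  rw [hZdef, hNdef, commonZeroCount, rationalPointCount] at hZN
  obtain ⟨x, hxN, hxZ⟩ := Finset.exists_mem_notMem_of_card_lt_card hZN
  simp only [Finset.mem_filter, Finset.mem_univ, true_and] at hxN hxZ
  exact ⟨x, hxN, fun h => hxZ ⟨hxN, h⟩⟩

/-- **`LangWeilBound`** (stmt-ValiantsHypothesis-6376), with `a = 6`: from the tree's Cafure–Matera
Thm. 5.2 and Lemma 2.2. -/
theorem langWeilBound_proof :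
    Summit.ValiantsHypothesis.ValiantsHypothesis.Theses.LangWeilTransfer.LangWeilBound := by
  refine ⟨6, ?_⟩
  intro K _ _ m Q G hQ hG hlt
  rcases m with _ | k
  · exact exists_point_fin_one Q G hQ hG
  · exact exists_point_of_pos k Q G hQ hG hlt

end Summit.ValiantsHypothesis.ValiantsHypothesis.Theorems.LangWeilTransfer
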